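import Summits.QuantumFields.YangMills.Theorems.BalabanUVNodesN16HolderMSDefs
import HarnessLib

/-!
# Route «BalabanUVNodes», cluster K4 «SpineRates» — node N16 = NE3: R-β″ ASKS LESS THAN THE DECL OF RECORD AT EVERY `β ≤ 1`
# AND IS EQUIVALENT TO IT AT `β = 1` (`CovRootHolderMS … 1 ↔ NE3EnergyRateWCov`, `N16HolderMSAt c 1 ↔ N16At c`, `S_N16HolderMS 1 ↔ S_N16`)

Cell `pub-ymgap`, seat `pub-ymgap-dag-n16-c` (R134 fan-out seat, strategy s1; HUMAN RULING D-0062; chair R424 venue), generation 4, file 39 — the RULING AID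
for the located item «the Hölder-exponent pin of N16's N05-socket» (`HOME/pub-ymgap-dag-n16-c/LOCATED-N16-HOLDER-PIN.md` ADDENDA 5–6; bus
DAGN16C-G4-INTENT-12).  `--supports stmt-QuantumFields-19912` (K3‴ `SpineGivenEndpointR13`, route rev 16; kernel lane, theorems only).
`bears_on: R4∕N16 · edge N05 → N16 · out-edges N16 → N19∕N21`.

WHY.  Generation 4 typed repair R-β″ end to end: the MS β-root `N16HolderMSDefs.CovRootHolderMS d 𝒞 L N b g C Λ₁ Λ₂' β dom` — the covariant root of record
whose third conjunct is print's [Balaban1985BackgroundPropagators] (3.40) Hölder quotient read MULTI-SCALE (all separations `1 ≤ j ≤ L^k` along lattice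
lines, transported by the line holonomy) — is PRODUCED from node N05's leaf at every `β ∈ (0,1]` (`N16HolderMSOfLeafTop.n16_holderMS_of_b8LeafRS`) and
CONSUMED by NE7 below the plaquette margin for every `β > 0` (`N16HolderMSDefs.closeness_of_covRootHolderMS`).  The ruling «adopt the token
`N16At ↦ N16HolderMSAt · β`?» then wants ONE more fact, typed here: the new token is NEVER STRONGER than the decl of record — `N16At c` implies
`N16HolderMSAt c β` for every `β ≤ 1` — and AT `β = 1` IT IS THE DECL OF RECORD (`N16HolderMSAt c 1 ↔ N16At c`).  The content is the
elementary TELESCOPING of covariant differences along a lattice line with UNITARY transport: the nearest-neighbour second covariant difference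
bound `≤ Λ₂′ξ³` of record ((Lip₂′ᶜ), `ξ := L^{−k}`), summed over `j` consecutive bonds and transported isometrically, is the multi-scale member
`≤ Λ₂′ξ³·j = Λ₂′ξ^{2+1}j^1` at `β = 1`; and the MS member is ANTITONE in `β` because `ξ·j ≤ 1` for `j ≤ L^k`.  Unitarity of the transport
`rescale L (bavg L U_B)` comes from `Regular` (inside the root) by `NE7EtaRatesD4CovReg.unitary_periodic_rescale_bavg_of_regular` (`d = 4`, `0 ≤ b`,
`512·5·8·L²·b ≤ 1` — the substrate's k-free averaging condition, a letter of every consumer already).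

CONTENTS.  §1 `xi_rpow_mul_rpow_anti` (`ξ^{2+β}j^β ≤ ξ^{2+β′}j^{β′}` for `β′ ≤ β`, `1 ≤ j ≤ L^k`), `CovRootHolderMS.anti` (general `d`; `1 ≤ L`, `0 ≤ Λ₂′`, `β′ ≤ β`).  §2 `norm_lineTransport_sub_le_sum` (unitary line-transport
telescoping), `covRootHolderMS_of_covRootHolder_one` (`d = 4`).  §3 `covRootHolderMS_one_iff`, `covRootHolderMS_one_iff_ne3EnergyRateWCov`,
`covRootHolderMS_of_ne3EnergyRateWCov` (every `β ≤ 1`), `n16HolderMSAt_one_iff`, `n16HolderMSAt_of_n16At`, `s_N16HolderMS_one_iff`, `s_N16HolderMS_of_s_N16`.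
HONEST FRAMING: folklore lattice-gauge kinematics about hypothesis SHAPES; nothing of Bałaban's proved; nothing asserted for any bundle; the located item
remains a PLANNER∕director question; N16 ∕ NE3 NOT discharged; count-neutral; one finite T⁴ at fixed ε — NOT ℝ⁴, NOT infinite volume, NOT OS, NOT a mass
gap, NOT Clay.
-/

set_option autoImplicit false

open scoped BigOperators Matrix Matrix.Norms.L2Operator

namespace Summit.QuantumFields.YangMills.BalabanUVNodes.N16HolderMSOneIff

open Literature.MathematicalPhysics.QuantumFieldTheory.Balaban1983to89
open B7Prop1Explicit B7Prop2Explicit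
open T4AveragingDeficitWall hiding Site Plane Plaq Bond
open T4AveragingDeficitWallBoundary (periodBox)
open Summit.QuantumFields.BalabanUV.T4Continuum
open AveragingDeficitPeriodicCounting (IsPeriodicDir)
open T4AveragingDeficitNonAbelian (Ad_mul Ad_sub)
open AveragingDeficitTransport (norm_Ad_of_unitary)
open AveragingDeficitNearIdentity (Ad_one)
open MinimalActionSandwich (IsMinimiser)
open MinimalActionRate (Regular sfClass)
open NE3EnergyShapes (residualScale IsUnitarySite IsPeriodicSite)
open NE3EnergyWeightedShapes (energyNormW)
open NE3EnergyWeightedCovShape (NE3EnergyRateWCov)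
open NE7EtaCovariantJunction (lineHol_succ lineHol_mem_unitary)
open NE7EtaRatesD4CovReg (unitary_periodic_rescale_bavg_of_regular)
open Literature.MathematicalPhysics.QuantumFieldTheory.Balaban1983to89.T4Continuum (T4Family ULoop)
open YMDAG.UVSplit (NE3Carriers RateCarriers RateRecordPred Datum N16At S_N16)
open N16HolderDefs (CovRootHolder N16HolderAt covRootHolder_one_iff n16HolderAt_iff n16HolderAt_one_iff)
open N16HolderMSDefs (CovRootHolderMS N16HolderMSAt S_N16HolderMS covRootHolder_of_covRootHolderMS n16HolderMSAt_iff)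

noncomputable section

variable {d : ℕ} {n : Type*} [Fintype n] [DecidableEq n]

/-! ## §1 The MS member is ANTITONE in the exponent: `ξ·j ≤ 1` for `j ≤ L^k` -/

/-- The scale-and-separation weight `ξ^{2+β}·j^β` (`ξ := (L⁻¹)^k`) is antitone in `β` on `1 ≤ j ≤ L^k` (`L ≥ 1`): for `β′ ≤ β`,
`ξ^{2+β}·j^β = ξ^{2+β′}·j^{β′}·(ξ·j)^{β−β′} ≤ ξ^{2+β′}·j^{β′}` since `0 ≤ ξ·j ≤ 1`. [folklore] -/
theorem xi_rpow_mul_rpow_anti {L : ℕ} (hL : 1 ≤ L) (k : ℕ) {j : ℕ} (hj1 : 1 ≤ j) (hjk : j ≤ L ^ k) {β β' : ℝ} (hββ' : β' ≤ β) :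
    (((L : ℝ)⁻¹) ^ k) ^ ((2 : ℝ) + β) * (j : ℝ) ^ β ≤ (((L : ℝ)⁻¹) ^ k) ^ ((2 : ℝ) + β') * (j : ℝ) ^ β' := by
  have hL0 : (0 : ℝ) < (L : ℝ) := by exact_mod_cast (by omega : 0 < L)
  set ξ : ℝ := ((L : ℝ)⁻¹) ^ k with hξ
  have hξ0 : 0 < ξ := pow_pos (inv_pos.mpr hL0) k
  have hj0 : (0 : ℝ) < (j : ℝ) := by exact_mod_cast (by omega : 0 < j)
  have hξj : ξ * (j : ℝ) ≤ 1 := by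
    rw [hξ, inv_pow, inv_mul_le_iff₀ (pow_pos hL0 k), mul_one]
    exact_mod_cast hjk
  have hsplit1 : ξ ^ ((2 : ℝ) + β) = ξ ^ ((2 : ℝ) + β') * ξ ^ (β - β') := by
    rw [← Real.rpow_add hξ0]; congr 1; ring
  have hsplit2 : (j : ℝ) ^ β = (j : ℝ) ^ β' * (j : ℝ) ^ (β - β') := by
    rw [← Real.rpow_add hj0]; congr 1; ring
  have hprod : ξ ^ (β - β') * (j : ℝ) ^ (β - β') = (ξ * (j : ℝ)) ^ (β - β') :=
    (Real.mul_rpow hξ0.le hj0.le).symm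
  have hle1 : (ξ * (j : ℝ)) ^ (β - β') ≤ 1 :=
    Real.rpow_le_one (mul_nonneg hξ0.le hj0.le) hξj (sub_nonneg.mpr hββ')
  have hnn : 0 ≤ ξ ^ ((2 : ℝ) + β') * (j : ℝ) ^ β' :=
    mul_nonneg (Real.rpow_nonneg hξ0.le _) (Real.rpow_nonneg hj0.le _)
  calc ξ ^ ((2 : ℝ) + β) * (j : ℝ) ^ β
      = ξ ^ ((2 : ℝ) + β') * (j : ℝ) ^ β' * (ξ ^ (β - β') * (j : ℝ) ^ (β - β')) := by
        rw [hsplit1, hsplit2]; ring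
    _ = ξ ^ ((2 : ℝ) + β') * (j : ℝ) ^ β' * (ξ * (j : ℝ)) ^ (β - β') := by rw [hprod]
    _ ≤ ξ ^ ((2 : ℝ) + β') * (j : ℝ) ^ β' * 1 := mul_le_mul_of_nonneg_left hle1 hnn
    _ = ξ ^ ((2 : ℝ) + β') * (j : ℝ) ^ β' := mul_one _

/-- **THE MS β-ROOT IS ANTITONE IN `β`** (`L ≥ 1`, `Λ₂′ ≥ 0`): `CovRootHolderMS … β dom → CovRootHolderMS … β′ dom` for every `β′ ≤ β` — a stronger
Hölder exponent at the producer only helps; every other conjunct is `β`-free. [folklore] -/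
theorem CovRootHolderMS.anti {𝒞 : ℕ → Set (Site d → Fin d → (Matrix n n ℂ)ˣ)} {L N : ℕ} (hL : 1 ≤ L) {b g C Λ₁ Λ₂' β β' : ℝ}
    (hΛ : 0 ≤ Λ₂') (hββ' : β' ≤ β) {dom : Set (Site d → Fin d → (Matrix n n ℂ)ˣ)}
    (h : CovRootHolderMS d 𝒞 L N b g C Λ₁ Λ₂' β dom) : CovRootHolderMS d 𝒞 L N b g C Λ₁ Λ₂' β' dom := by
  intro k hk V hV UA UB hA hB hreg
  obtain ⟨u, Z, hu, huP, hZs, hZP, hg, hE, hL1, hL2⟩ := h k hk V hV UA UB hA hB hreg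
  refine ⟨u, Z, hu, huP, hZs, hZP, hg, hE, hL1, fun κ μ y j hj1 hjk => (hL2 κ μ y j hj1 hjk).trans ?_⟩
  rw [mul_assoc, mul_assoc]
  exact mul_le_mul_of_nonneg_left (xi_rpow_mul_rpow_anti hL k hj1 hjk hββ') hΛ

/-! ## §2 Telescoping along a lattice line with UNITARY transport; the NN `β = 1` member of record gives the MS member at `β = 1` -/

/-- **LINE-TRANSPORT TELESCOPING** (`W` unitary): for any sequence `X : ℕ → 𝕄` read along the `μ`-line from `b` and the line holonomy
`P_j := W(b) μ · W(b + e_μ) μ ⋯ W(b + (j−1)e_μ) μ`, `‖Ad(P_j)(X j) − X 0‖ ≤ Σ_{i<j} ‖Ad(W(b + i e_μ) μ)(X (i+1)) − X i‖` — each consecutive difference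
is transported by the unitary `P_i`, an isometry. [folklore] -/
theorem norm_lineTransport_sub_le_sum {W : Site d → Fin d → (Matrix n n ℂ)ˣ} (hW : IsUnitaryCfg W) (b : Site d) (μ : Fin d)
    (X : ℕ → Matrix n n ℂ) (j : ℕ) :
    ‖Ad (((List.range j).map fun i : ℕ => W (b + i • e μ) μ).prod) (X j) - X 0‖
      ≤ ∑ i ∈ Finset.range j, ‖Ad (W (b + i • e μ) μ) (X (i + 1)) - X i‖ := by
  induction j with
  | zero => simp [Ad_one]
  | succ j ih =>
    rw [Finset.sum_range_succ, lineHol_succ, Ad_mul]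
    have hPu := lineHol_mem_unitary hW b μ j
    calc ‖Ad (((List.range j).map fun i : ℕ => W (b + i • e μ) μ).prod) (Ad (W (b + j • e μ) μ) (X (j + 1))) - X 0‖
        = ‖Ad (((List.range j).map fun i : ℕ => W (b + i • e μ) μ).prod) (Ad (W (b + j • e μ) μ) (X (j + 1)) - X j)
            + (Ad (((List.range j).map fun i : ℕ => W (b + i • e μ) μ).prod) (X j) - X 0)‖ := by
          rw [Ad_sub]; congr 1; abel
      _ ≤ ‖Ad (((List.range j).map fun i : ℕ => W (b + i • e μ) μ).prod) (Ad (W (b + j • e μ) μ) (X (j + 1)) - X j)‖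
            + ‖Ad (((List.range j).map fun i : ℕ => W (b + i • e μ) μ).prod) (X j) - X 0‖ := norm_add_le _ _
      _ = ‖Ad (W (b + j • e μ) μ) (X (j + 1)) - X j‖
            + ‖Ad (((List.range j).map fun i : ℕ => W (b + i • e μ) μ).prod) (X j) - X 0‖ := by
          rw [norm_Ad_of_unitary hPu]
      _ ≤ (∑ i ∈ Finset.range j, ‖Ad (W (b + i • e μ) μ) (X (i + 1)) - X i‖)
            + ‖Ad (W (b + j • e μ) μ) (X (j + 1)) - X j‖ := by linarith [ih]

/-- **THE ROOT OF RECORD AT `β = 1` GIVES THE MS ROOT AT `β = 1`** (`d = 4`, `L ≥ 1`, `0 ≤ b`, `512·5·8·L²·b ≤ 1`): inside the root `U_B` is regular,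
so `W := rescale L (bavg L U_B)` is unitary (`unitary_periodic_rescale_bavg_of_regular`); the nearest-neighbour member (Lip₂′ᶜ) `≤ Λ₂′ξ^{2+1}` at the
`j` consecutive base points `y, y + e_μ, …` telescopes (`norm_lineTransport_sub_le_sum`) to the multi-scale member `≤ Λ₂′ξ^{2+1}·j^1`. [folklore] -/
theorem covRootHolderMS_of_covRootHolder_one [Nonempty n] {𝒞 : ℕ → Set (Site 4 → Fin 4 → (Matrix n n ℂ)ˣ)} {L N : ℕ} (hL : 1 ≤ L)
    {b g C Λ₁ Λ₂' : ℝ} (hb : 0 ≤ b) (hbs : 512 * (4 + 1) * (4 + 4) * (L : ℝ) ^ 2 * b ≤ 1)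
    {dom : Set (Site 4 → Fin 4 → (Matrix n n ℂ)ˣ)} (h : CovRootHolder 4 𝒞 L N b g C Λ₁ Λ₂' 1 dom) :
    CovRootHolderMS 4 𝒞 L N b g C Λ₁ Λ₂' 1 dom := by
  intro k hk V hV UA UB hA hB hreg
  obtain ⟨u, Z, hu, huP, hZs, hZP, hg, hE, hL1, hL2⟩ := h k hk V hV UA UB hA hB hreg
  obtain ⟨hWu, -⟩ := unitary_periodic_rescale_bavg_of_regular hL hb hbs hreg
  refine ⟨u, Z, hu, huP, hZs, hZP, hg, hE, hL1, fun κ μ y j _ _ => ?_⟩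
  -- the NN member at the consecutive base points `y + i•e μ`
  have hstep : ∀ i : ℕ,
      ‖Ad (rescale L (bavg L UB) (y + e κ + i • e μ) μ)
            (Ad (rescale L (bavg L UB) (y + e κ + (i + 1) • e μ) μ) (Z (y + (i + 1 + 1) • e μ) κ) - Z (y + (i + 1) • e μ) κ)
          - (Ad (rescale L (bavg L UB) (y + e κ + i • e μ) μ) (Z (y + (i + 1) • e μ) κ) - Z (y + i • e μ) κ)‖
        ≤ Λ₂' * (((L : ℝ)⁻¹) ^ k) ^ ((2 : ℝ) + 1) := by
    intro i
    have h2 := hL2 κ μ (y + i • e μ)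
    have e1 : y + i • e μ + e κ = y + e κ + i • e μ := by abel
    have e2 : y + e κ + i • e μ + e μ = y + e κ + (i + 1) • e μ := by rw [succ_nsmul]; abel
    have e3 : y + i • e μ + (2 : ℕ) • e μ = y + (i + 1 + 1) • e μ := by simp only [succ_nsmul]; abel
    have e4 : y + i • e μ + e μ = y + (i + 1) • e μ := by rw [succ_nsmul]; abel
    rw [e1, e2, e3, e4] at h2
    exact h2
  -- telescoping with the unitary line transport from the base `y + e κ`
  have htel := norm_lineTransport_sub_le_sum hWu (y + e κ) μ
    (fun i : ℕ => Ad (rescale L (bavg L UB) (y + e κ + i • e μ) μ) (Z (y + (i + 1) • e μ) κ) - Z (y + i • e μ) κ) j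
  simp only [zero_smul, add_zero, zero_add, one_smul] at htel
  refine htel.trans ?_
  calc ∑ i ∈ Finset.range j,
        ‖Ad (rescale L (bavg L UB) (y + e κ + i • e μ) μ)
              (Ad (rescale L (bavg L UB) (y + e κ + (i + 1) • e μ) μ) (Z (y + (i + 1 + 1) • e μ) κ) - Z (y + (i + 1) • e μ) κ)
            - (Ad (rescale L (bavg L UB) (y + e κ + i • e μ) μ) (Z (y + (i + 1) • e μ) κ) - Z (y + i • e μ) κ)‖
      ≤ ∑ _i ∈ Finset.range j, Λ₂' * (((L : ℝ)⁻¹) ^ k) ^ ((2 : ℝ) + 1) := Finset.sum_le_sum fun i _ => hstep i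
    _ = Λ₂' * (((L : ℝ)⁻¹) ^ k) ^ ((2 : ℝ) + 1) * (j : ℝ) ^ (1 : ℝ) := by
        rw [Finset.sum_const, Finset.card_range, nsmul_eq_mul, Real.rpow_one]; ring

/-! ## §3 The `β = 1` equivalences and «R-β″ asks less than the record at every `β ≤ 1`», at the three levels -/

/-- **AT `β = 1` THE MS ROOT IS THE β-ROOT** (`d = 4`, `L ≥ 1`, `0 ≤ b`, `512·5·8·L²·b ≤ 1`). [folklore] -/
theorem covRootHolderMS_one_iff [Nonempty n] {𝒞 : ℕ → Set (Site 4 → Fin 4 → (Matrix n n ℂ)ˣ)} {L N : ℕ} (hL : 1 ≤ L)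
    {b g C Λ₁ Λ₂' : ℝ} (hb : 0 ≤ b) (hbs : 512 * (4 + 1) * (4 + 4) * (L : ℝ) ^ 2 * b ≤ 1)
    {dom : Set (Site 4 → Fin 4 → (Matrix n n ℂ)ˣ)} :
    CovRootHolderMS 4 𝒞 L N b g C Λ₁ Λ₂' 1 dom ↔ CovRootHolder 4 𝒞 L N b g C Λ₁ Λ₂' 1 dom :=
  ⟨covRootHolder_of_covRootHolderMS hL, covRootHolderMS_of_covRootHolder_one hL hb hbs⟩

/-- **AT `β = 1` THE MS ROOT IS THE ROOT OF RECORD `NE3EnergyRateWCov`** (`d = 4`, same letters). [folklore] -/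
theorem covRootHolderMS_one_iff_ne3EnergyRateWCov [Nonempty n] {𝒞 : ℕ → Set (Site 4 → Fin 4 → (Matrix n n ℂ)ˣ)} {L N : ℕ}
    (hL : 1 ≤ L) {b g C Λ₁ Λ₂' : ℝ} (hb : 0 ≤ b) (hbs : 512 * (4 + 1) * (4 + 4) * (L : ℝ) ^ 2 * b ≤ 1)
    {dom : Set (Site 4 → Fin 4 → (Matrix n n ℂ)ˣ)} :
    CovRootHolderMS 4 𝒞 L N b g C Λ₁ Λ₂' 1 dom ↔ NE3EnergyRateWCov 4 𝒞 L N b g C Λ₁ Λ₂' dom :=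
  (covRootHolderMS_one_iff hL hb hbs).trans covRootHolder_one_iff

/-- **THE ROOT OF RECORD GIVES THE MS β-ROOT FOR EVERY `β ≤ 1`** (`d = 4`, `L ≥ 1`, `0 ≤ b`, `512·5·8·L²·b ≤ 1`, `0 ≤ Λ₂′`): R-β″'s root is never
stronger than the record's. [folklore] -/
theorem covRootHolderMS_of_ne3EnergyRateWCov [Nonempty n] {𝒞 : ℕ → Set (Site 4 → Fin 4 → (Matrix n n ℂ)ˣ)} {L N : ℕ} (hL : 1 ≤ L)
    {b g C Λ₁ Λ₂' β : ℝ} (hb : 0 ≤ b) (hbs : 512 * (4 + 1) * (4 + 4) * (L : ℝ) ^ 2 * b ≤ 1) (hΛ : 0 ≤ Λ₂') (hβ : β ≤ 1)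
    {dom : Set (Site 4 → Fin 4 → (Matrix n n ℂ)ˣ)} (h : NE3EnergyRateWCov 4 𝒞 L N b g C Λ₁ Λ₂' dom) :
    CovRootHolderMS 4 𝒞 L N b g C Λ₁ Λ₂' β dom :=
  CovRootHolderMS.anti hL hΛ hβ (covRootHolderMS_of_covRootHolder_one hL hb hbs (covRootHolder_one_iff.mpr h))

/-- **AT `β = 1` THE CANDIDATE TOKEN IS THE VENUE DECL: `N16HolderMSAt c 1 ↔ N16At c`** (block factor `c.L ≥ 1`, small-field letter `0 ≤ c.b` with the
substrate's averaging condition `512·5·8·c.L²·c.b ≤ 1`). [folklore] -/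
theorem n16HolderMSAt_one_iff {N : ℕ} [NeZero N] (c : NE3Carriers N) (hL : 1 ≤ c.L) (hb : 0 ≤ c.b)
    (hbs : 512 * (4 + 1) * (4 + 4) * (c.L : ℝ) ^ 2 * c.b ≤ 1) : N16HolderMSAt c 1 ↔ N16At c :=
  (n16HolderMSAt_iff c 1).trans
    ((covRootHolderMS_one_iff hL hb hbs).trans ((n16HolderAt_iff c 1).symm.trans (n16HolderAt_one_iff c)))

/-- **THE VENUE DECL GIVES THE CANDIDATE TOKEN AT EVERY `β ≤ 1`: `N16At c → N16HolderMSAt c β`** (same letters, `0 ≤ c.Λ₂′`). [folklore] -/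
theorem n16HolderMSAt_of_n16At {N : ℕ} [NeZero N] {c : NE3Carriers N} (h : N16At c) (hL : 1 ≤ c.L) (hb : 0 ≤ c.b)
    (hbs : 512 * (4 + 1) * (4 + 4) * (c.L : ℝ) ^ 2 * c.b ≤ 1) (hΛ : 0 ≤ c.Λ₂') {β : ℝ} (hβ : β ≤ 1) :
    N16HolderMSAt c β :=
  CovRootHolderMS.anti hL hΛ hβ ((n16HolderMSAt_one_iff c hL hb hbs).mpr h)

section Stub

variable {N : ℕ} [NeZero N]

/-- **AT `β = 1` THE CANDIDATE STUB IS THE STUB OF RECORD: `S_N16HolderMS 1 RRec ↔ S_N16 RRec`**, provided every bundle OF RECORD has block factor `≥ 1`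
and a small-field letter `0 ≤ b` with `512·5·8·L²·b ≤ 1`. [folklore] -/
theorem s_N16HolderMS_one_iff (RRec : RateRecordPred N)
    (hside : ∀ (F : T4Family) (D : Datum F N) (g₀ : ℕ → ℝ) (os : List (ULoop F)) (R : RateCarriers N), RRec F D g₀ os R →
      1 ≤ R.ne3.L ∧ 0 ≤ R.ne3.b ∧ 512 * (4 + 1) * (4 + 4) * (R.ne3.L : ℝ) ^ 2 * R.ne3.b ≤ 1) :
    S_N16HolderMS 1 RRec ↔ S_N16 RRec := by
  refine ⟨fun h F D g₀ os R hR => ?_, fun h F D g₀ os R hR => ?_⟩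
  · obtain ⟨hL, hb, hbs⟩ := hside F D g₀ os R hR
    exact (n16HolderMSAt_one_iff R.ne3 hL hb hbs).mp (h F D g₀ os R hR)
  · obtain ⟨hL, hb, hbs⟩ := hside F D g₀ os R hR
    exact (n16HolderMSAt_one_iff R.ne3 hL hb hbs).mpr (h F D g₀ os R hR)

/-- **THE STUB OF RECORD GIVES THE CANDIDATE STUB AT EVERY `β ≤ 1`: `S_N16 RRec → S_N16HolderMS β RRec`** (side letters per bundle of record:
`1 ≤ L`, `0 ≤ b`, `512·5·8·L²·b ≤ 1`, `0 ≤ Λ₂′`). [folklore] -/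
theorem s_N16HolderMS_of_s_N16 {RRec : RateRecordPred N} (h : S_N16 RRec)
    (hside : ∀ (F : T4Family) (D : Datum F N) (g₀ : ℕ → ℝ) (os : List (ULoop F)) (R : RateCarriers N), RRec F D g₀ os R →
      1 ≤ R.ne3.L ∧ 0 ≤ R.ne3.b ∧ 512 * (4 + 1) * (4 + 4) * (R.ne3.L : ℝ) ^ 2 * R.ne3.b ≤ 1 ∧ 0 ≤ R.ne3.Λ₂')
    {β : ℝ} (hβ : β ≤ 1) : S_N16HolderMS β RRec := by
  intro F D g₀ os R hR
  obtain ⟨hL, hb, hbs, hΛ⟩ := hside F D g₀ os R hR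
  exact n16HolderMSAt_of_n16At (h F D g₀ os R hR) hL hb hbs hΛ hβ

end Stub

end

end Summit.QuantumFields.YangMills.BalabanUVNodes.N16HolderMSOneIff
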